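import Summits.ABC.IUTFork.Joshi.MochizukiAnsatzLocal
import HarnessLib

/-!
# Joshi's Galois symmetry of the Ansatz is an ISOMETRY on the readings: it preserves every valuation scale (Prop. 6.7.1 /
# 6.13.1 + Thm. 6.9.1), so the `j²`-rescaling between the labels is produced by NO Galois move

Record file of the abc-iut cell, branch E (rung LADDER-ABC:A2.E; seat abc-iut-E-t2), object side (E-PLAN R14: no OUR-side import;
nearest FQNs in docstrings only), over abc-iut-E-t3's carrier `PrototypeDatum` (`Joshi/PrimitiveAnsatz`) and my `Joshi/MochizukiAnsatzLocal`
(`galPts`, `mochizukiAnsatz`). Source: K. Joshi, arXiv:2303.01662v3 [J-IIp] (bib `Joshi2023ATS2Local`, render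
`HOME/lit/renders/Joshi-arxiv-2303.01662/`), with the [J-II] (arXiv:2111.04890, bib `Joshi2021ATS2`) sentence it types: §10 chunk p0015 l. 91–92
«It is certainly enough to work with the (finite) union of `G_{E′}`-orbit of the point of `Σ_F` constructed in the proof … where `E′`
runs over all the finitely many extensions `E′ ⊂ \bar ℚ_p` which are anabelomorphic with `E` i.e. `G_{E′} ≃ G_E` (in the context of
[IUT — citation bracket empty in the chunk render; editorial interpolation], this corresponds to "Mochizuki's Indeterminacy Ind1")». TAKES NO SIDE on [IUTchIII] Cor. 3.12 or on any author; typed ≠ proved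
≠ endorsed; unrefereed source.

## What is shown (all DERIVED from E-t3's signature fields: `pt_gal`, `absF_galF`, `absK_pt` = [FF18, Prop. 2.2.17], `absK_emb`)

* `scale_galY_pt` — for an Ansatz parameter `a ∈ 𝔪_F ∖ 0` and `σ ∈ G`: `scale(σ·y_a) = scale(y_a)`, i.e. `v_{K_{σ(y_a)}}(p) =
  v_{K_{y_a}}(p)` ([J-IIp] Prop. 6.7.1, p. 17 l. 1–23: «`σ([a^{j²}] − p) = [σ(a)^{j²}] − p`» with the isometry of the Galois action on
  `F = ℂ_p^♭`; «`(σ(y_1), …, σ(y_{ℓ⋆}))` has similar valuation theoretic properties as `(y_1, …, y_{ℓ⋆})`», [J-II] §7 chunk p0010 l. 59).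
* `absK_emb_galY_pt` — hence EVERY `z ∈ Ē` is read with the same size at `y_a` and at `σ·y_a`: the Galois symmetry is an isometry
  of the readings.
* `scale_galPts_ansatzPt`, `absK_emb_galPts_ansatzPt` — along a whole Ansatz tuple, label by label.
* CONTRAST (by name, E-t3's `Joshi/LogLinkColumn`): the FROBENIUS move rescales, `|p|_{K_{φ(y_a)}} = |p|_{K_{y_a}}^p`
  (`PeriodRingDatum.absK_p_frobY_pt`, [J-IIp] Thm. 10.20.1 (3)), and the passage between the ENTRIES of one tuple rescales by `j²`
  (`PrototypeDatum.scale_ansatzPt`, Thm. 6.9.1).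

READING (neutral, for dictionary row D-04 «closure moves of Θ̃ (Galois, φ, Aut(G_E)) ↦ elements of ⟨(Ind1) ∪ (Ind2)⟩» and my test's
`Y = Joshi.ATS2.PilotReading.QSide`, p428531/p429844): Joshi's own (Ind1)-analogue — the Galois symmetry — NEVER rescales, exactly like
OUR (Ind1)/(Ind2) at an isometric instantiation (`Thm311.LogShells.stripAut`/`ism`); the `j²`-rescaling that separates the q-pilot
reading from the Θ-pilot reading is therefore not supplied by any Galois move in Joshi's construction either: it sits in the choice
of the Ansatz point / the entry of the tuple at which the q-value is read (the subject of `QSide`, resp. of E-plan's `MovesAreInd` for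
point-changing moves). Located, not adjudicated. [claim: Joshi2023ATS2Local, status: disputed] [claim: Joshi2021ATS2, status: disputed]
-/

noncomputable section

open Set

namespace Summit.ABC.IUTFork.Joshi

namespace PrototypeDatum

variable {F B E0 : Type} [Field F] [CommRing B] [Field E0] {Y : Type} {K : Y → Type} [∀ y, Field (K y)] {G : Type}
  (P : PrototypeDatum F B E0 Y K G)

/-- Galois translates of Ansatz parameters are Ansatz parameters (the isometry `|σ(a)|_F = |a|_F`, E-t3's `absF_galF`; the
ingredient of Prop. 6.7.1). [folklore] -/
theorem galF_mem_ansatzParam (g : G) {a : F} (ha : a ∈ P.AnsatzParam) : P.galF g a ∈ P.AnsatzParam := by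
  refine ⟨fun h => ha.1 ?_, by rw [P.absF_galF]; exact ha.2⟩
  have := P.absF_galF g a
  rw [h, map_zero] at this
  exact (map_eq_zero P.absF).1 this.symm

/-- **The Galois symmetry preserves the valuation of `p`**: `|p|_{K_{σ·y_a}} = |p|_{K_{y_a}}` ([J-IIp] Prop. 6.7.1 p. 17 l. 1–23 with
[FF18, Prop. 2.2.17]: `σ·y_a = y_{σ(a)}` and `|p|_{K_{y_{σ(a)}}} = |σ(a)|_F = |a|_F = |p|_{K_{y_a}}`). DERIVED.
[claim: Joshi2023ATS2Local, status: disputed] -/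
theorem absK_p_galY_pt (g : G) {a : F} (ha : a ∈ P.AnsatzParam) :
    P.absK (P.galY g (P.pt a)) (P.p : K (P.galY g (P.pt a))) = P.absK (P.pt a) (P.p : K (P.pt a)) := by
  have hga := P.galF_mem_ansatzParam g ha
  rw [← P.pt_gal, P.absK_pt _ hga.1 hga.2, P.absK_pt a ha.1 ha.2, P.absF_galF]

/-- **`scale(σ·y_a) = scale(y_a)`** — Joshi's Galois symmetry (his (Ind1)-analogue, [J-II] §10 «this corresponds to Mochizuki's
Indeterminacy Ind1») is an ISOMETRY on the valuation scales of the Ansatz points. DERIVED. [claim: Joshi2023ATS2Local, status: disputed] -/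
theorem scale_galY_pt (g : G) {a : F} (ha : a ∈ P.AnsatzParam) : P.scale (P.galY g (P.pt a)) = P.scale (P.pt a) := by
  apply P.rpow_abs0_p_inj
  rw [← P.absK_natCast_p, ← P.absK_natCast_p]
  exact P.absK_p_galY_pt g ha

/-- **Every `z ∈ Ē` is read with the same size at `y_a` and at `σ·y_a`** (Thm. 6.9.1 (3)'s reading law `|ι_y(z)|_{K_y} =
|z|_0^{scale y}` + `scale_galY_pt`). DERIVED. [claim: Joshi2023ATS2Local, status: disputed] -/
theorem absK_emb_galY_pt (g : G) {a : F} (ha : a ∈ P.AnsatzParam) (z : E0) :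
    P.absK (P.galY g (P.pt a)) (P.emb _ z) = P.absK (P.pt a) (P.emb _ z) := by
  rw [P.absK_emb, P.absK_emb, P.scale_galY_pt g ha]

/-- The Galois translate of the Ansatz tuple of `a` is the Ansatz tuple of `σ(a)` (the computation inside E-t3's
`primitiveAnsatz_gal`, Prop. 6.7.1: «`σ([a^{j²}] − p) = [σ(a)^{j²}] − p`»), in the `galPts` vocabulary of `Joshi/MochizukiAnsatzLocal`.
DERIVED. [claim: Joshi2023ATS2Local, status: disputed] -/
theorem galPts_ansatzPt (g : G) (a : F) : galPts P.toPeriodRingDatum g (P.ansatzPt a) = P.ansatzPt (P.galF g a) := by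
  funext i
  show P.galY g (P.pt _) = P.pt _
  rw [← P.pt_gal, map_pow]

/-- **Label by label, the Galois translate of an Ansatz tuple has the SAME valuation scales** (`scale(σ·y_j(a)) = scale(y_j(a)) =
j²·scale(y_a)`): the `j²`-profile of Thm. 6.9.1 is Galois-invariant and no Galois move alters it. DERIVED.
[claim: Joshi2023ATS2Local, status: disputed] -/
theorem scale_galPts_ansatzPt (g : G) {a : F} (ha : a ∈ P.AnsatzParam) (i : Fin P.lstar) :
    P.scale (galPts P.toPeriodRingDatum g (P.ansatzPt a) i) = P.scale (P.ansatzPt a i) := by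
  rw [P.galPts_ansatzPt, P.scale_ansatzPt (P.galF_mem_ansatzParam g ha) i, P.scale_ansatzPt ha i, P.pt_gal,
    P.scale_galY_pt g ha]

/-- … hence every `z ∈ Ē` — in particular the q-value and the theta values — is read with the same size at the `j`-th point of the
tuple and at its Galois translate. DERIVED. [claim: Joshi2023ATS2Local, status: disputed] -/
theorem absK_emb_galPts_ansatzPt (g : G) {a : F} (ha : a ∈ P.AnsatzParam) (i : Fin P.lstar) (z : E0) :
    P.absK (galPts P.toPeriodRingDatum g (P.ansatzPt a) i) (P.emb _ z) = P.absK (P.ansatzPt a i) (P.emb _ z) := by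
  rw [P.absK_emb, P.absK_emb, P.scale_galPts_ansatzPt g ha i]

/-- **The `j²`-rescaling is NOT a Galois move**: for `a ∈ 𝔪_F ∖ 0` and labels `j ≠ j′` NO `σ ∈ G` carries the scale of `y_j(a)` to that
of `y_{j′}(a)` — Galois translates keep the scale, while distinct labels have distinct scales (`j²·s ≠ j′²·s`, `s > 0`). DERIVED.
[claim: Joshi2023ATS2Local, status: disputed] -/
theorem scale_galY_ansatzPt_ne (g : G) {a : F} (ha : a ∈ P.AnsatzParam) {i i' : Fin P.lstar} (h : i ≠ i') :
    P.scale (P.galY g (P.ansatzPt a i)) ≠ P.scale (P.ansatzPt a i') := by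
  have hs := P.scale_pos (P.pt a)
  have hgal : P.scale (P.galY g (P.ansatzPt a i)) = P.scale (P.ansatzPt a i) := by
    have := P.scale_galPts_ansatzPt g ha i
    rwa [galPts] at this
  rw [hgal, P.scale_ansatzPt ha i, P.scale_ansatzPt ha i']
  intro heq
  have hii : ((((i : ℕ) + 1) ^ 2 : ℕ) : ℝ) = ((((i' : ℕ) + 1) ^ 2 : ℕ) : ℝ) :=
    mul_right_cancel₀ hs.ne' heq
  have hnat : ((i : ℕ) + 1) ^ 2 = ((i' : ℕ) + 1) ^ 2 := by exact_mod_cast hii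
  have hv : (i : ℕ) + 1 = (i' : ℕ) + 1 := Nat.pow_left_injective two_ne_zero hnat
  exact h (Fin.ext (by omega))

end PrototypeDatum

/-! ## On Mochizuki's Ansatz `Σ_{𝔍(X,E)}` (Def. 6.11.1): Prop. 6.13.1's Galois action preserves all scales of an Ansatz object -/

section AnsatzObjects

open Literature.AnabelianGeometry.SemiGraphs (TemperedCurve)

variable {F B E0 : Type} [Field F] [CommRing B] [Field E0] {Y : Type} {K : Y → Type} [∀ y, Field (K y)] {G : Type}
  {p : ℕ} [Fact p.Prime] {X : TemperedCurve p} {P : PrototypeDatum F B E0 Y K G}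

/-- **Prop. 6.13.1's Galois action on an Ansatz object preserves the valuation scale of every entry** (and so the sizes of every
`z ∈ Ē`, in particular of the values of the Tate parameter function read through `ι`): Joshi's (Ind1)-analogue is an isometry of the
readings on `Σ_{𝔍(X,E)}`. DERIVED. [claim: Joshi2023ATS2Local, status: disputed] [claim: Joshi2021ATS2, status: disputed] -/
theorem scale_galPts_of_mem_mochizukiAnsatz (g : G) {A : Fin P.lstar → Holomorphoid X P.toPeriodRingDatum}
    (hA : A ∈ mochizukiAnsatz X P) (i : Fin P.lstar) :
    P.scale (galPts P.toPeriodRingDatum g (Holomorphoid.pts A) i) = P.scale (Holomorphoid.pts A i) := by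
  obtain ⟨a, ha, hpts⟩ := hA
  rw [hpts]
  exact P.scale_galPts_ansatzPt g ha i

end AnsatzObjects

end Summit.ABC.IUTFork.Joshi

end
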